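import Summits.QuantumFields.BalabanUV.Beta.GAN24.FineReadoutDecay

/-!
# `BalabanUV.Beta.GAN24.FineReadoutCauchyTail` — binder row G-an2-4 / (CONV-C), S-slot located remainder, road «S3»: PART K of the located
# leaf «(N1-Cauchy)» of the RATE table — THE NEW-LABEL (SUB-ALIAS) TAIL OF THE FINER LEVEL'S MINIMISER COLUMN IS `O(1/N)`

**G-an2-4 FORMALISATION SWARM, `b2b-balaban-gan24-formalise-leaf-01` (gen 11) — PART K of «(N1-Cauchy)»** (owner's typed spec
`HOME/b2b-balaban-gan24-p1/N1-CAUCHY-SPEC.md` v1 §3; holder leaf-17's division `N1-CAUCHY-DIVISION.md` v1 §5 «sub-alias tails», CLAIM N1C-K).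
NOT IN PRINT; OUR PROOF ATTEMPT (of the road; THIS file is [folklore] bookkeeping over TREE theorems BY NAME: leaf-14's two-level alias
re-indexing `GAN24/AliasReindex` (`srep`, `lift`, `newLabels`, `exists_coord_of_mem_newLabels`), leaf-16's King currency `GAN24/AliasPointSum`
(`pointWeight`, `sum_pointWeight_srep_le` = King 1986 (4.22) reproduced in `King1986.AliasSums`), E3A2 `FineReadoutAlias.norm_Asol_border_le`,
E3A3 `FineReadoutApriori.column_apriori` / `FineReadoutSum.ampA_eq_Asol` / `norm_pw_repZ_le`, and at `d = 3` leaf-09's `FibreDetStripHolds.exists_strip`;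
no cited fact, no wall binder, no `def`, no `def … : Prop`).  HONEST FRAMING (cell contract, verbatim): «discharging `BetaPertH` makes Bałaban's UV
stability UNCONDITIONAL — a real constructive-QFT result; it is NOT the continuum limit and NOT the Clay problem.»  HONEST DEPENDENCY (verbatim):
«continuum YM on T⁴ ⇐ BetaPertH ∧ nine spine estimates (0/9 proved); BetaPertH ⇐ (D1) ∧ (D4) ∧ CAP+tail; G-an2-4 gates asym, D1 and NE2/3/4.»
Discharges NOTHING of (hS, hSall) / «E3Shape» / «E3SupRate»: PART K is ONE of the parts (F, N, A, C, K, S) of ONE located leaf of the five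
DIFF rows; «(N1-Cauchy)» stays OPEN until the holder's assembly lands; NOT `BetaPertH`, NOT continuum, NOT Clay.

## Where PART K sits, and the ONE design point it settles
The holder's frame (`FineReadoutCauchyFrame.cellMean_sub_eq_re_latticeKernel`) reduces «(N1-Cauchy)» to a bound on the difference symbol
`(Lc^{d+1})⁻¹·N′^{d+2}·Σ_{r ∈ box Lc} (F_{N′}⁻¹)_{(κ,Lc•z+r),(Q,l)}(p) − N^{d+2}·(F_N⁻¹)_{(κ,z),(Q,l)}(p)`, `N′ = N·Lc`.  Each inverse-fibre
entry is the plane-wave synthesis of its alias amplitudes (`FibreDFTDictionary.boxData_inl_eq_sum`: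
`(F_{N′}⁻¹)_{(κ,z′),(Q,l)} = Σ_{m′ ∈ (ℤ/N′)^{d+1}} Â′_{m′κ}·e^{i k′_{m′}·z′}`), and the two levels are compared LABEL BY LABEL.
**The matching is by the SYMMETRIC representative** — `AliasReindex.lift N′ m = (srep m : (ℤ/N′)^{d+1})`, `srep (lift N′ m) = srep m`
(`AliasReindex` §1 «Representative»: matching by the nonnegative representative `val`, i.e. the sub-alias `t = 0` of
`AliasNest.nest (N·Lc) N m t`, pairs the level-`N` class `val = N − 1` (alias `−1`, weight `O(1)`) with the FAR level-`N′` class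
`val = N − 1` (weight `O(N⁻²)`) whenever `srep m` has a negative coordinate — not a small difference; the matched sub-alias is
`t_i = 0` where `srep m i ≥ 0` and `t_i = Lc − 1` where `srep m i < 0`, which is exactly `lift`).  So the finer level's alias sum SPLITS as
`Σ_{m′} = Σ_m (· ∘ lift N′) + Σ_{m′ ∈ newLabels N N′}` (`AliasReindex.sum_eq_sum_lift_add_sum_newLabels`, road P1's L11 pattern):
the matched terms are PART A, the new labels — classes with a symmetric coordinate OUTSIDE the level-`N` window `(−N/2, N/2]` — are PART K,
this file.  NO geometric-sum factor and NO derivative gain is needed for the tail: a new label is FAR, `‖srep m′‖∞ ≥ N/2`, so ONE inverse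
power of the sup norm in King's point-reading weight is worth `2/N`, and the remaining exponent `α + 1 ∈ {0, −1} < 1` is still window-free.

## What is proved (generic `D`/`d`, block sides `N, N′ ≥ 1` UNRELATED unless said; `K_D = √12^D·√6·(1+8D)`,
## `C₀ = (3π)·3^D·aliasConst D 0`, `C₁ = (3π)²·3^D·aliasConst D (−1)`)
* §1 `zero_not_mem_newLabels`, `ne_zero_of_mem_newLabels`, `half_le_norm_realVec_srep` (`N/2 ≤ ‖srep m′‖∞` on `newLabels N N′`),
  `pointWeight_eq_inv_mul` (`pointWeight α j = ‖j‖⁻¹·pointWeight (α+1) j`), **`pointWeight_le_of_mem_newLabels`**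
  (`pointWeight α (srep m′) ≤ (2/N)·pointWeight (α+1) (srep m′)`), **`sum_newLabels_pointWeight_le`** (`α < 0`, `D ≥ 1`):
  `Σ_{m′ ∈ newLabels N N′} pointWeight α (srep m′) ≤ (2/N)·(3π)^{−α}·3^D·aliasConst D (α+1)` — uniform in `N′`.
* §2 **`sum_newLabels_norm_le`** (CONSUMER FORM, any normed target, any currency of amplitudes): a family with
  `‖F m′‖ ≤ B·(a·pointWeight(−1) + b·pointWeight(−2))(srep m′)` on `m′ ≠ 0` has `Σ_{newLabels N N′} ‖F m′‖ ≤ B·(2/N)·(a·C₀ + b·C₁)`.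
* §3 (the E3A currency, COMPLEX `p` with `|Re p_i| ≤ π`, `|Im p_i| ≤ η`, `0 ≤ η ≤ 1/4`, `(3D/2+2)η ≤ 1/2`; (U1)+A at the FINER side `N′`:
  `det F_{N′}(p) ≠ 0`, a scaled a-priori pair `(r, r₀, A)`) `norm_ampA_le_pointWeight` (the termwise step of E3A3(c), exported:
  `‖Â_{mκ}‖ ≤ A·(N^{d+2})⁻¹·K·(r₀²·pointWeight(−1) + r₀³·pointWeight(−2))(srep m)`, `m ≠ 0`),
  **`sum_newLabels_norm_ampA_pw_le`**: `Σ_{m′ ∈ newLabels N N′} ‖Â′_{m′κ}·e^{i k′_{m′}·z′}‖ ≤ e^{(d+1)η}·A·(N′^{d+2})⁻¹·K·(2/N)·(r₀²C₀ + r₀³C₁)`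
  for every fine site `z′` of side `N′`, and the CELL-MEAN form **`norm_cellMean_newLabels_le`** in the shape of the holder's `diffSym`
  (prefactor `(Lc^{d+1})⁻¹·N′^{d+2}`, cell `proj N′ (Lc•z + toSite r)`, `r ∈ box (d+1) Lc`): `≤ e^{(d+1)η}·A·K·(2/N)·(r₀²C₀ + r₀³C₁)`,
  ANY `Lc ≥ 1`.
* §4 (`d = 3`, every `Lc ≥ 1`) **`exists_newLabels_tail`**: `∃ κ₁ > 0, C ≥ 0, ∀ n, ∀ p ∈ Strip 4 κ₁, ∀ l κ z′,
  Σ_{m′ ∈ newLabels (Lc^(n+1)) (Lc^(n+2))} ‖Â′_{m′κ}(p)·e^{i k′_{m′}·z′}‖ ≤ C·((Lc^(n+2))^5)⁻¹·(Lc⁻¹)^(n+1)` — PART K UNCONDITIONALLY, geometric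
  in the member with ratio `θ = Lc⁻¹` after the finer level's normalisation `N′^{d+2}`, with ONE strip for all levels (as (N1)
  `FineReadoutDecay.exists_wH_decay`; the real zone `η = 0` is included).
Consumer: the holder's PART S (`AliasReindex.norm_sum_sub_sum_le_of_rates` takes exactly `hτ : Σ_{newLabels} ‖F′ m′‖ ≤ τ`; PART A (leaf-16)
supplies the matched rates).  0 sorry; axioms {propext, Classical.choice, Quot.sound}.  Unit `b2b-balaban-gan24-formalise-leaf-01` (gen 11), 2026-08-20.
-/

noncomputable section

open Complex Finset Matrix
open scoped BigOperators Real Matrix.Norms.L2Operator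
open Literature.Probability.LatticeModels (TorusSite Torus.proj)
open Literature.MathematicalPhysics.QuantumFieldTheory.LatticeForm (repZ)
open Literature.MathematicalPhysics.QuantumFieldTheory.Balaban1983to89
open Literature.MathematicalPhysics.QuantumFieldTheory.Balaban1983to89.Beta
open Literature.MathematicalPhysics.QuantumFieldTheory.King1986 (aliasConst)
open B4Strip (Strip reVec)
open BlochFibreMatrix (Idx stencil pieceMatrix)
open FibreInverseDecay (trigPolySymbol)
open AffineAveraging (box toSite)
open Summit.QuantumFields.BalabanUV.Beta.GAN24.FibreSymbols (pw lapSym)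
open Summit.QuantumFields.BalabanUV.Beta.GAN24.FibreDFT (kFine)
open Summit.QuantumFields.BalabanUV.Beta.GAN24.FibreDFTDictionary (ampA)
open Summit.QuantumFields.BalabanUV.Beta.GAN24.AliasObjects (chiAl sbAl dAl dbAl LAl)
open Summit.QuantumFields.BalabanUV.Beta.GAN24.AliasReindex (srep lift newLabels srep_lift lift_not_mem_newLabels
  exists_coord_of_mem_newLabels sum_eq_sum_lift_add_sum_newLabels)
open Summit.QuantumFields.BalabanUV.Beta.GAN24.ArrowOperator (arrowMat)
open Summit.QuantumFields.BalabanUV.Beta.GAN24.ArrowScaling (scaledArrow radI radO radI_pos radO_pos)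
open Summit.QuantumFields.BalabanUV.Beta.GAN24.StripLegApriori (radO_zero_le_two_pi)
open Summit.QuantumFields.BalabanUV.Beta.GAN24.CombesThomasFibre (fibInv)
open Summit.QuantumFields.BalabanUV.Beta.GAN24.AliasPointSum (realVec pointWeight pointWeight_nonneg abs_le_norm_realVec
  sum_pointWeight_srep_le srep_ne_zero)
open Summit.QuantumFields.BalabanUV.Beta.GAN24.FineReadoutAlias (wfold Fsup wfold_nonneg one_le_Fsup norm_Asol_border_le)
open Summit.QuantumFields.BalabanUV.Beta.GAN24.FineReadoutApriori (column_apriori)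
open Summit.QuantumFields.BalabanUV.Beta.GAN24.FineReadoutSum (norm_pw_repZ_le ampA_eq_Asol pointWeight_neg_one_eq
  pointWeight_neg_two_eq)
open Summit.QuantumFields.BalabanUV.Beta.GAN24.FibreDetStripHolds (exists_strip strip_mono)

namespace Summit.QuantumFields.BalabanUV.Beta.GAN24.FineReadoutCauchyTail

/-! ## §1 The King tail on the new labels of the finer level -/

section King

variable {D N N' : ℕ} [NeZero N] [NeZero N']

/-- [folklore] The zero class is never a new label (its symmetric coordinates are `0 ∈ (−N/2, N/2]`). -/
theorem zero_not_mem_newLabels : (0 : TorusSite D N') ∉ (newLabels N N' : Finset (TorusSite D N')) := by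
  intro h
  obtain ⟨i, hi⟩ := exists_coord_of_mem_newLabels h
  have h0 : srep (0 : TorusSite D N') i = 0 := by
    rw [AliasReindex.srep_apply]; exact ZMod.valMinAbs_zero N'
  rw [h0, abs_zero, mul_zero] at hi
  have hN : (0 : ℤ) < N := by exact_mod_cast Nat.pos_of_ne_zero (NeZero.ne N)
  omega

/-- [folklore] A new label is a nonzero class. -/
theorem ne_zero_of_mem_newLabels {m' : TorusSite D N'} (h : m' ∈ (newLabels N N' : Finset (TorusSite D N'))) : m' ≠ 0 :=
  fun h0 => zero_not_mem_newLabels (N := N) (h0 ▸ h)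

/-- [folklore] The new labels are among the nonzero classes. -/
theorem newLabels_subset_filter_ne_zero :
    (newLabels N N' : Finset (TorusSite D N')) ⊆ (Finset.univ : Finset (TorusSite D N')).filter (fun m' => m' ≠ 0) :=
  fun _ hm' => Finset.mem_filter.2 ⟨Finset.mem_univ _, ne_zero_of_mem_newLabels hm'⟩

omit [NeZero N] in
/-- [folklore] **A NEW LABEL IS FAR**: `N/2 ≤ ‖srep m′‖∞`. -/
theorem half_le_norm_realVec_srep {m' : TorusSite D N'} (h : m' ∈ (newLabels N N' : Finset (TorusSite D N'))) :
    (N : ℝ) / 2 ≤ ‖realVec (srep m')‖ := by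
  obtain ⟨i, hi⟩ := exists_coord_of_mem_newLabels h
  have hi' : (N : ℝ) ≤ 2 * |((srep m' i : ℤ) : ℝ)| := by
    rw [← Int.cast_abs]; exact_mod_cast hi
  have hle := abs_le_norm_realVec (srep m') i
  unfold realVec at hle ⊢
  linarith

/-- [folklore] Shifting King's exponent by one costs exactly one inverse power of the sup norm:
`pointWeight α j = ‖j‖⁻¹ · pointWeight (α+1) j` (`j ≠ 0`). -/
theorem pointWeight_eq_inv_mul {d : ℕ} (α : ℝ) {j : Fin d → ℤ} (hj : j ≠ 0) :
    pointWeight α j = ‖realVec j‖⁻¹ * pointWeight (α + 1) j := by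
  have hpos : 0 < ‖realVec j‖ := lt_of_lt_of_le one_pos (AliasPointSum.one_le_norm_realVec hj)
  unfold pointWeight
  rw [← mul_assoc, ← Real.rpow_neg_one, ← Real.rpow_add hpos]; congr 2; ring

/-- [folklore] **ONE POWER OF `1/N` FROM A NEW LABEL**: `pointWeight α (srep m′) ≤ (2/N) · pointWeight (α+1) (srep m′)`. -/
theorem pointWeight_le_of_mem_newLabels {m' : TorusSite D N'} (h : m' ∈ (newLabels N N' : Finset (TorusSite D N')))
    (α : ℝ) : pointWeight α (srep m') ≤ 2 / N * pointWeight (α + 1) (srep m') := by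
  have hm' := ne_zero_of_mem_newLabels h
  have hN : (0 : ℝ) < N := by exact_mod_cast Nat.pos_of_ne_zero (NeZero.ne N)
  rw [pointWeight_eq_inv_mul α (srep_ne_zero hm')]
  refine mul_le_mul_of_nonneg_right ?_ (pointWeight_nonneg _ _)
  have hhalf := half_le_norm_realVec_srep h
  calc ‖realVec (srep m')‖⁻¹ ≤ ((N : ℝ) / 2)⁻¹ := inv_anti₀ (by positivity) hhalf
    _ = 2 / N := by rw [inv_div]

/-- [folklore] **THE KING TAIL ON THE NEW LABELS** (`D ≥ 1`, `α < 0`): the `p`-free point-reading weights of the new labels sum to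
`≤ (2/N) · (3π)^{1−(α+1)} · 3^D · aliasConst D (α+1)` — ONE POWER OF `1/N` below King's window-free bound at the shifted
exponent `α + 1 < 1`, uniformly in the finer block side `N′`. -/
theorem sum_newLabels_pointWeight_le (hD : 0 < D) {α : ℝ} (hα : α < 0) :
    ∑ m' ∈ (newLabels N N' : Finset (TorusSite D N')), pointWeight α (srep m')
      ≤ 2 / N * ((3 * π) ^ (1 - (α + 1)) * (3 : ℝ) ^ D * aliasConst D (α + 1)) := by
  have hN : (0 : ℝ) < N := by exact_mod_cast Nat.pos_of_ne_zero (NeZero.ne N)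
  calc ∑ m' ∈ (newLabels N N' : Finset (TorusSite D N')), pointWeight α (srep m')
      ≤ ∑ m' ∈ (newLabels N N' : Finset (TorusSite D N')), 2 / N * pointWeight (α + 1) (srep m') :=
        Finset.sum_le_sum fun m' hm' => pointWeight_le_of_mem_newLabels hm' α
    _ = 2 / N * ∑ m' ∈ (newLabels N N' : Finset (TorusSite D N')), pointWeight (α + 1) (srep m') := by
        rw [Finset.mul_sum]
    _ ≤ 2 / N * ∑ m' ∈ (Finset.univ : Finset (TorusSite D N')).filter (fun m' => m' ≠ 0), pointWeight (α + 1) (srep m') :=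
        mul_le_mul_of_nonneg_left
          (Finset.sum_le_sum_of_subset_of_nonneg newLabels_subset_filter_ne_zero fun m' _ _ => pointWeight_nonneg _ _)
          (by positivity)
    _ ≤ 2 / N * ((3 * π) ^ (1 - (α + 1)) * (3 : ℝ) ^ D * aliasConst D (α + 1)) :=
        mul_le_mul_of_nonneg_left (sum_pointWeight_srep_le hD (by linarith)) (by positivity)

end King

/-! ## §2 The tail of a King-majorised alias family (consumer form) -/

section Majorised

variable {D N N' : ℕ} [NeZero N] [NeZero N'] {E : Type*} [SeminormedAddCommGroup E]

/-- [folklore] **THE NEW-LABEL TAIL OF A KING-MAJORISED FAMILY**: if `‖F m′‖ ≤ B·(a·pointWeight(−1) + b·pointWeight(−2))(srep m′)`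
on every nonzero class of the finer level `N′` (the currency of E3A2 `FineReadoutAlias.norm_Asol_border_le` — transverse part
`a = r₀²`, pure-gauge part `b = r₀³`), then
`Σ_{m′ ∈ newLabels N N′} ‖F m′‖ ≤ B · (2/N) · (a·C₀ + b·C₁)`, `C₀ = (3π)·3^D·aliasConst D 0`, `C₁ = (3π)²·3^D·aliasConst D (−1)`
(`D ≥ 1`; uniform in `N′`). -/
theorem sum_newLabels_norm_le (hD : 0 < D) (F : TorusSite D N' → E) {B a b : ℝ} (hB : 0 ≤ B) (ha : 0 ≤ a) (hb : 0 ≤ b)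
    (hF : ∀ m' : TorusSite D N', m' ≠ 0 →
      ‖F m'‖ ≤ B * (a * pointWeight (-1) (srep m') + b * pointWeight (-2) (srep m'))) :
    ∑ m' ∈ (newLabels N N' : Finset (TorusSite D N')), ‖F m'‖
      ≤ B * (2 / N) * (a * ((3 * π) ^ (1 - (0 : ℝ)) * (3 : ℝ) ^ D * aliasConst D 0)
          + b * ((3 * π) ^ (1 - (-1 : ℝ)) * (3 : ℝ) ^ D * aliasConst D (-1))) := by
  have hN : (0 : ℝ) < N := by exact_mod_cast Nat.pos_of_ne_zero (NeZero.ne N)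
  have h1 := sum_newLabels_pointWeight_le (N := N) (N' := N') hD (α := -1) (by norm_num)
  have h2 := sum_newLabels_pointWeight_le (N := N) (N' := N') hD (α := -2) (by norm_num)
  norm_num only at h1 h2
  calc ∑ m' ∈ (newLabels N N' : Finset (TorusSite D N')), ‖F m'‖
      ≤ ∑ m' ∈ (newLabels N N' : Finset (TorusSite D N')),
          B * (a * pointWeight (-1) (srep m') + b * pointWeight (-2) (srep m')) :=
        Finset.sum_le_sum fun m' hm' => hF m' (ne_zero_of_mem_newLabels hm')
    _ = B * (a * ∑ m' ∈ (newLabels N N' : Finset (TorusSite D N')), pointWeight (-1) (srep m')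
          + b * ∑ m' ∈ (newLabels N N' : Finset (TorusSite D N')), pointWeight (-2) (srep m')) := by
        rw [← Finset.mul_sum, Finset.sum_add_distrib, ← Finset.mul_sum, ← Finset.mul_sum]
    _ ≤ B * (a * (2 / N * ((3 * π) ^ (1 - (0 : ℝ)) * (3 : ℝ) ^ D * aliasConst D 0))
          + b * (2 / N * ((3 * π) ^ (1 - (-1 : ℝ)) * (3 : ℝ) ^ D * aliasConst D (-1)))) := by
        refine mul_le_mul_of_nonneg_left (add_le_add (mul_le_mul_of_nonneg_left ?_ ha) (mul_le_mul_of_nonneg_left ?_ hb)) hB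
        · norm_num only; exact h1
        · norm_num only; exact h2
    _ = _ := by ring

end Majorised

/-! ## §3 The instance: the new-label tail of the finer level's minimiser column on the strip, under (U1)+A at that level -/

section Column

variable {d N N' : ℕ} [NeZero N] [NeZero N'] {p : Fin (d + 1) → ℂ} {η : ℝ}

/-- [folklore] **THE PER-ALIAS BOUND OF THE MINIMISER COLUMN IN KING'S CURRENCY** (`m ≠ 0`; the termwise step inside E3A3(c)
`FineReadoutSum.norm_fibInv_inl_inr_le`, exported): under (U1)+A at block side `N` (strip point with `det ≠ 0`, scaled a-priori pair of
border radius `r₀` and constant `A`),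
`‖Â_{mκ}‖ ≤ A·(N^{d+2})⁻¹·K_{d+1}·(r₀²·pointWeight(−1) + r₀³·pointWeight(−2))(srep m)`, `K_D = √12^D·√6·(1+8D)`. -/
theorem norm_ampA_le_pointWeight (hre : ∀ i, |(p i).re| ≤ π) (him : ∀ i, |(p i).im| ≤ η) (hη : 0 ≤ η) (hη4 : η ≤ 1 / 4)
    (hηD : (3 * (d + 1 : ℕ) / 2 + 2) * η ≤ 1 / 2)
    (hdet : (trigPolySymbol (stencil (d + 1)) (pieceMatrix (N := N)) p).det ≠ 0)
    {r : TorusSite (d + 1) N → ℝ} (hr : ∀ m, 0 < r m) {r0 : ℝ} (hr0 : 0 < r0) {A : ℝ} (hA0 : 0 ≤ A)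
    (hU : IsUnit (arrowMat (scaledArrow N r r0 p))) (hA : ‖(arrowMat (scaledArrow N r r0 p))⁻¹‖ ≤ A)
    (l κ : Fin (d + 1)) {m : TorusSite (d + 1) N} (hm : m ≠ 0) :
    ‖ampA p (fun i => fibInv N i (Sum.inr (Sum.inr l)) p) m κ‖
      ≤ A * ((N : ℝ) ^ (d + 1 + 1))⁻¹ * (Real.sqrt 12 ^ (d + 1) * (Real.sqrt 6 * (1 + 8 * (d + 1 : ℕ)))) *
          (r0 ^ 2 * pointWeight (-1) (srep m) + r0 ^ 3 * pointWeight (-2) (srep m)) := by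
  classical
  set v : Idx (d + 1) N → ℂ := fun i => fibInv N i (Sum.inr (Sum.inr l)) p with hv
  set B : ℝ := A * ((N : ℝ) ^ (d + 1 + 1))⁻¹ with hB
  set K : ℝ := Real.sqrt 12 ^ (d + 1) * (Real.sqrt 6 * (1 + 8 * (d + 1 : ℕ))) with hK
  have hN : (0 : ℝ) < N := by exact_mod_cast Nat.pos_of_ne_zero (NeZero.ne N)
  obtain ⟨c, hx, -, hφ, hc⟩ := column_apriori hr hr0 p hA0 hdet hU hA l
  set Φ : ℝ := r0 ^ 2 / (N : ℝ) ^ 3 * A * ((N : ℝ) ^ (d + 1 + 1))⁻¹ with hΦ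
  set Cc : ℝ := r0 ^ 3 / (N : ℝ) ^ 3 * A * ((N : ℝ) ^ (d + 1 + 1))⁻¹ with hCc
  have hΦ' : ∀ κ', ‖v (Sum.inr (Sum.inr κ'))‖ ≤ Φ := fun κ' => hφ κ'
  have hA2 := norm_Asol_border_le (D := d + 1) hre him hη hη4 hηD hm (φ := fun κ' => v (Sum.inr (Sum.inr κ'))) (c := c) hΦ' hc κ
  have hLm : lapSym (kFine p m) ≠ 0 := by
    have hpos := FineReadoutAlias.lapR_pos (N := N) (p := p) hre hm
    have hhalf := FineReadoutAlias.half_lapR_le_norm_LAl (N := N) hre him hη hηD hm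
    intro h0
    have : ‖LAl N p m‖ = 0 := by rw [show LAl N p m = lapSym (kFine p m) from rfl, h0, norm_zero]
    linarith
  rw [← ampA_eq_Asol hx m hLm] at hA2
  have hre' : (Real.sqrt 12 ^ (d + 1) * (Real.sqrt 6 * (1 + 8 * (d + 1 : ℕ)))) * (N : ℝ) ^ 3 * (Φ / Fsup m ^ 2 + Cc / Fsup m ^ 3) *
        ∏ i, wfold m i
      = B * K * (r0 ^ 2 * pointWeight (-1) (srep m) + r0 ^ 3 * pointWeight (-2) (srep m)) := by
    rw [← pointWeight_neg_one_eq hm, ← pointWeight_neg_two_eq hm, hΦ, hCc, hB, hK]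
    field_simp
  rw [hre'] at hA2
  exact hA2

/-- [folklore] **THE NEW-LABEL TAIL OF THE FINER LEVEL'S MINIMISER COLUMN AT A FINE SITE** (PART K of «(N1-Cauchy)», pointwise form):
under (U1)+A at the FINER block side `N′` (strip point, `det ≠ 0`, scaled a-priori pair `(r, r₀, A)`), for every coarser side `N ≥ 1`
and every fine site `z′`,
`Σ_{m′ ∈ newLabels N N′} ‖Â′_{m′κ} · e^{i k′_{m′}·z′}‖ ≤ e^{(d+1)η}·A·(N′^{d+2})⁻¹·K_{d+1}·(2/N)·(r₀²·C₀ + r₀³·C₁)` —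
the normalised tail `N′^{d+2}·(…)` is `O(1/N)`, uniformly in `N′`, `p`, `κ`, `l`, `z′` (`C₀ = (3π)·3^{d+1}·aliasConst (d+1) 0`,
`C₁ = (3π)²·3^{d+1}·aliasConst (d+1) (−1)`: King's exponents shifted by one, still `< 1`). -/
theorem sum_newLabels_norm_ampA_pw_le (hre : ∀ i, |(p i).re| ≤ π) (him : ∀ i, |(p i).im| ≤ η) (hη : 0 ≤ η) (hη4 : η ≤ 1 / 4)
    (hηD : (3 * (d + 1 : ℕ) / 2 + 2) * η ≤ 1 / 2)
    (hdet : (trigPolySymbol (stencil (d + 1)) (pieceMatrix (N := N')) p).det ≠ 0)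
    {r : TorusSite (d + 1) N' → ℝ} (hr : ∀ m, 0 < r m) {r0 : ℝ} (hr0 : 0 < r0) {A : ℝ} (hA0 : 0 ≤ A)
    (hU : IsUnit (arrowMat (scaledArrow N' r r0 p))) (hA : ‖(arrowMat (scaledArrow N' r r0 p))⁻¹‖ ≤ A)
    (l κ : Fin (d + 1)) (z' : TorusSite (d + 1) N') :
    ∑ m' ∈ (newLabels N N' : Finset (TorusSite (d + 1) N')),
        ‖ampA p (fun i => fibInv N' i (Sum.inr (Sum.inr l)) p) m' κ * pw (kFine p m') (repZ z')‖
      ≤ Real.exp ((d + 1) * η) * A * ((N' : ℝ) ^ (d + 1 + 1))⁻¹ *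
          (Real.sqrt 12 ^ (d + 1) * (Real.sqrt 6 * (1 + 8 * (d + 1 : ℕ)))) * (2 / N) *
          (r0 ^ 2 * ((3 * π) ^ (1 - (0 : ℝ)) * (3 : ℝ) ^ (d + 1) * aliasConst (d + 1) 0)
            + r0 ^ 3 * ((3 * π) ^ (1 - (-1 : ℝ)) * (3 : ℝ) ^ (d + 1) * aliasConst (d + 1) (-1))) := by
  set E : ℝ := Real.exp ((d + 1) * η) with hE
  set B : ℝ := A * ((N' : ℝ) ^ (d + 1 + 1))⁻¹ with hB
  set K : ℝ := Real.sqrt 12 ^ (d + 1) * (Real.sqrt 6 * (1 + 8 * (d + 1 : ℕ))) with hK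
  have hE0 : 0 ≤ E := (Real.exp_pos _).le
  have hB0 : 0 ≤ B := by positivity
  have hK0 : 0 ≤ K := by positivity
  have hF : ∀ m' : TorusSite (d + 1) N', m' ≠ 0 →
      ‖ampA p (fun i => fibInv N' i (Sum.inr (Sum.inr l)) p) m' κ * pw (kFine p m') (repZ z')‖
        ≤ E * B * K * (r0 ^ 2 * pointWeight (-1) (srep m') + r0 ^ 3 * pointWeight (-2) (srep m')) := by
    intro m' hm'
    rw [norm_mul]
    have h1 := norm_ampA_le_pointWeight hre him hη hη4 hηD hdet hr hr0 hA0 hU hA l κ hm'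
    have h2 := norm_pw_repZ_le him m' z'
    have hW : 0 ≤ r0 ^ 2 * pointWeight (-1) (srep m') + r0 ^ 3 * pointWeight (-2) (srep m') := by
      have := pointWeight_nonneg (-1) (srep m'); have := pointWeight_nonneg (-2) (srep m'); positivity
    calc _ ≤ (B * K * (r0 ^ 2 * pointWeight (-1) (srep m') + r0 ^ 3 * pointWeight (-2) (srep m'))) * E :=
          mul_le_mul h1 h2 (norm_nonneg _) (by positivity)
      _ = E * B * K * (r0 ^ 2 * pointWeight (-1) (srep m') + r0 ^ 3 * pointWeight (-2) (srep m')) := by ring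
  have h := sum_newLabels_norm_le (D := d + 1) (N := N) (Nat.succ_pos d) _ (B := E * B * K) (a := r0 ^ 2) (b := r0 ^ 3)
    (by positivity) (by positivity) (by positivity) hF
  refine h.trans (le_of_eq ?_)
  rw [hB]; ring

/-- [folklore] **PART K, CELL-MEAN FORM** (the shape in which the holder's `FineReadoutCauchyFrame.diffSym` carries the finer level:
prefactor `(Lc^{d+1})⁻¹·N′^{d+2}`, cell `{Lc•z + r : r ∈ box Lc}` read through `proj N′`): for ANY block sides `N, N′, Lc ≥ 1`,
`‖(Lc^{d+1})⁻¹·N′^{d+2}·Σ_{r ∈ box Lc} Σ_{m′ ∈ newLabels N N′} Â′_{m′κ}·e^{i k′_{m′}·(Lc•z+r)}‖ ≤ e^{(d+1)η}·A·K_{d+1}·(2/N)·(r₀²C₀ + r₀³C₁)`. -/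
theorem norm_cellMean_newLabels_le (hre : ∀ i, |(p i).re| ≤ π) (him : ∀ i, |(p i).im| ≤ η) (hη : 0 ≤ η) (hη4 : η ≤ 1 / 4)
    (hηD : (3 * (d + 1 : ℕ) / 2 + 2) * η ≤ 1 / 2)
    (hdet : (trigPolySymbol (stencil (d + 1)) (pieceMatrix (N := N')) p).det ≠ 0)
    {r : TorusSite (d + 1) N' → ℝ} (hr : ∀ m, 0 < r m) {r0 : ℝ} (hr0 : 0 < r0) {A : ℝ} (hA0 : 0 ≤ A)
    (hU : IsUnit (arrowMat (scaledArrow N' r r0 p))) (hA : ‖(arrowMat (scaledArrow N' r r0 p))⁻¹‖ ≤ A)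
    (Lc : ℕ) [NeZero Lc] (l κ : Fin (d + 1)) (z : Fin (d + 1) → ℤ) :
    ‖(((Lc : ℂ) ^ (d + 1))⁻¹ * ((N' : ℂ) ^ (d + 2)) *
        ∑ rr ∈ box (d + 1) Lc, ∑ m' ∈ (newLabels N N' : Finset (TorusSite (d + 1) N')),
          ampA p (fun i => fibInv N' i (Sum.inr (Sum.inr l)) p) m' κ
            * pw (kFine p m') (repZ (Torus.proj N' ((Lc : ℤ) • z + toSite rr))))‖
      ≤ Real.exp ((d + 1) * η) * A * (Real.sqrt 12 ^ (d + 1) * (Real.sqrt 6 * (1 + 8 * (d + 1 : ℕ)))) * (2 / N) *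
          (r0 ^ 2 * ((3 * π) ^ (1 - (0 : ℝ)) * (3 : ℝ) ^ (d + 1) * aliasConst (d + 1) 0)
            + r0 ^ 3 * ((3 * π) ^ (1 - (-1 : ℝ)) * (3 : ℝ) ^ (d + 1) * aliasConst (d + 1) (-1))) := by
  set T : ℝ := Real.exp ((d + 1) * η) * A * ((N' : ℝ) ^ (d + 1 + 1))⁻¹ *
      (Real.sqrt 12 ^ (d + 1) * (Real.sqrt 6 * (1 + 8 * (d + 1 : ℕ)))) * (2 / N) *
      (r0 ^ 2 * ((3 * π) ^ (1 - (0 : ℝ)) * (3 : ℝ) ^ (d + 1) * aliasConst (d + 1) 0)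
        + r0 ^ 3 * ((3 * π) ^ (1 - (-1 : ℝ)) * (3 : ℝ) ^ (d + 1) * aliasConst (d + 1) (-1))) with hT
  have hN' : (0 : ℝ) < N' := by exact_mod_cast Nat.pos_of_ne_zero (NeZero.ne N')
  have hLc : (0 : ℝ) < Lc := by exact_mod_cast Nat.pos_of_ne_zero (NeZero.ne Lc)
  have hcard : (box (d + 1) Lc).card = Lc ^ (d + 1) := by
    simp [AffineAveraging.box, Fintype.card_piFinset, Finset.card_range, Finset.prod_const, Finset.card_univ, Fintype.card_fin]
  have hcell : ∀ rr ∈ box (d + 1) Lc, ‖∑ m' ∈ (newLabels N N' : Finset (TorusSite (d + 1) N')),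
      ampA p (fun i => fibInv N' i (Sum.inr (Sum.inr l)) p) m' κ
        * pw (kFine p m') (repZ (Torus.proj N' ((Lc : ℤ) • z + toSite rr)))‖ ≤ T := fun rr _ =>
    (norm_sum_le _ _).trans (sum_newLabels_norm_ampA_pw_le hre him hη hη4 hηD hdet hr hr0 hA0 hU hA l κ _)
  have hsum := (norm_sum_le _ _).trans (Finset.sum_le_sum hcell)
  rw [Finset.sum_const, hcard, nsmul_eq_mul] at hsum
  have hpre : ‖((Lc : ℂ) ^ (d + 1))⁻¹ * ((N' : ℂ) ^ (d + 2))‖ = ((Lc : ℝ) ^ (d + 1))⁻¹ * (N' : ℝ) ^ (d + 2) := by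
    rw [norm_mul, norm_inv, norm_pow, norm_pow, Complex.norm_natCast, Complex.norm_natCast]
  rw [norm_mul, hpre]
  calc ((Lc : ℝ) ^ (d + 1))⁻¹ * (N' : ℝ) ^ (d + 2) * _ ≤ ((Lc : ℝ) ^ (d + 1))⁻¹ * (N' : ℝ) ^ (d + 2) * (((Lc ^ (d + 1) : ℕ) : ℝ) * T) :=
        mul_le_mul_of_nonneg_left hsum (by positivity)
    _ = _ := by
        rw [hT]; push_cast; field_simp

end Column

/-! ## §4 `d = 3`: PART K unconditionally, at every pair of consecutive levels, from road P1's (U1)+A -/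

section Four

variable {Lc : ℕ} [NeZero Lc]

/-- [folklore] **PART K OF «(N1-Cauchy)», UNCONDITIONAL AT `d = 3`**: ONE half-width `κ₁ > 0` and ONE constant `C ≥ 0` such that for EVERY member
`n`, every strip point `p ∈ Strip 4 κ₁`, every `l κ` and every fine site `z′` of the finer level `N′ = Lc^(n+2)`,
`Σ_{m′ ∈ newLabels (Lc^(n+1)) (Lc^(n+2))} ‖Â′_{m′κ}(p)·e^{i k′_{m′}·z′}‖ ≤ C · ((Lc^(n+2))^5)⁻¹ · (Lc⁻¹)^(n+1)` — after the finer level's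
normalisation `N′^{d+2} = (Lc^(n+2))^5` the new-label tail of the cell-mean comparison is GEOMETRIC IN THE MEMBER with ratio `θ = Lc⁻¹`
(inputs: leaf-09's `FibreDetStripHolds.exists_strip` BY NAME, exactly as in (N1) `FineReadoutDecay.exists_wH_decay`). -/
theorem exists_newLabels_tail :
    ∃ κ₁ C : ℝ, 0 < κ₁ ∧ 0 ≤ C ∧ ∀ (n : ℕ) (p : Fin (3 + 1) → ℂ), p ∈ Strip (3 + 1) κ₁ →
      ∀ (l κ : Fin (3 + 1)) (z' : TorusSite (3 + 1) (Lc ^ (n + 2))),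
        ∑ m' ∈ (newLabels (Lc ^ (n + 1)) (Lc ^ (n + 2)) : Finset (TorusSite (3 + 1) (Lc ^ (n + 2)))),
            ‖ampA p (fun i => fibInv (Lc ^ (n + 2)) i (Sum.inr (Sum.inr l)) p) m' κ * pw (kFine p m') (repZ z')‖
          ≤ C * ((((Lc ^ (n + 2) : ℕ) : ℝ)) ^ 5)⁻¹ * ((Lc : ℝ)⁻¹) ^ (n + 1) := by
  obtain ⟨ρ₀, κ₀, A, hρ₀, hκ₀, _hκρ, hκ4, hA, hdet, hpair⟩ := exists_strip (d := 3) (Lc := Lc)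
  set κ₁ : ℝ := min κ₀ (1 / 16) with hκ₁
  have hκ₁0 : 0 < κ₁ := lt_min hκ₀ (by norm_num)
  have hκ₁le : κ₁ ≤ κ₀ := min_le_left _ _
  have hκ₁4 : κ₁ ≤ 1 / 4 := (min_le_right _ _).trans (by norm_num)
  have hκ₁D : (3 * (3 + 1 : ℕ) / 2 + 2) * κ₁ ≤ 1 / 2 := by
    have := min_le_right κ₀ (1 / 16 : ℝ); push_cast; nlinarith
  set R0 : ℝ := 2 * π with hR0
  have hR0pos : 0 < R0 := by rw [hR0]; positivity
  set K : ℝ := Real.sqrt 12 ^ (3 + 1) * (Real.sqrt 6 * (1 + 8 * (3 + 1 : ℕ))) with hK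
  set C0 : ℝ := (3 * π) ^ (1 - (0 : ℝ)) * (3 : ℝ) ^ (3 + 1) * aliasConst (3 + 1) 0 with hC0
  set C1 : ℝ := (3 * π) ^ (1 - (-1 : ℝ)) * (3 : ℝ) ^ (3 + 1) * aliasConst (3 + 1) (-1) with hC1
  have hC0' : 0 ≤ C0 := mul_nonneg (by positivity) (FineReadoutDecay.aliasConst_nonneg (Nat.succ_pos 3) (by norm_num))
  have hC1' : 0 ≤ C1 := mul_nonneg (by positivity) (FineReadoutDecay.aliasConst_nonneg (Nat.succ_pos 3) (by norm_num))
  refine ⟨κ₁, Real.exp ((3 + 1) * κ₁) * A * K * 2 * (R0 ^ 2 * C0 + R0 ^ 3 * C1), hκ₁0, by positivity, fun n p hp l κ z' => ?_⟩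
  haveI : NeZero (Lc ^ (n + 2)) := ⟨pow_ne_zero _ (NeZero.ne Lc)⟩
  haveI : NeZero (Lc ^ (n + 1)) := ⟨pow_ne_zero _ (NeZero.ne Lc)⟩
  have hp0 : p ∈ Strip (3 + 1) κ₀ := fun μ => ⟨(hp μ).1, (hp μ).2.trans hκ₁le⟩
  have hdet₁ := hdet (n + 1) p hp0
  -- the scaled a-priori pair at the finer level, border radius ≤ 2π
  obtain ⟨r, r0, hr, hr0, hr0R, hU, hAi⟩ : ∃ (r : TorusSite (3 + 1) (Lc ^ (n + 1 + 1)) → ℝ) (r0 : ℝ), (∀ m, 0 < r m) ∧ 0 < r0 ∧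
      r0 ≤ R0 ∧ IsUnit (arrowMat (scaledArrow (Lc ^ (n + 1 + 1)) r r0 p)) ∧ ‖(arrowMat (scaledArrow (Lc ^ (n + 1 + 1)) r r0 p))⁻¹‖ ≤ A := by
    have hq : ∀ i, |reVec p i| ≤ π := fun i => (hp0 i).1
    rcases hpair (n + 1) p hp0 with ⟨_, hU, hAi⟩ | ⟨_, _, hq0, hU, hAi⟩
    · refine ⟨radI (Lc ^ (n + 1 + 1)), 1, radI_pos, one_pos, ?_, hU, hAi⟩
      rw [hR0]; have := Real.pi_gt_three; linarith
    · exact ⟨radO (Lc ^ (n + 1 + 1)) (reVec p), radO (Lc ^ (n + 1 + 1)) (reVec p) 0, radO_pos hq hq0, radO_pos hq hq0 0,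
        radO_zero_le_two_pi hq, hU, hAi⟩
  have h := sum_newLabels_norm_ampA_pw_le (N := Lc ^ (n + 1)) (N' := Lc ^ (n + 2)) (fun i => (hp i).1) (fun i => (hp i).2)
    hκ₁0.le hκ₁4 hκ₁D hdet₁ hr hr0 hA hU hAi l κ z'
  refine h.trans ?_
  have hLc : (0 : ℝ) < Lc := by exact_mod_cast Nat.pos_of_ne_zero (NeZero.ne Lc)
  have hW : R0 ^ 2 * C0 + R0 ^ 3 * C1 ≥ r0 ^ 2 * C0 + r0 ^ 3 * C1 := by
    have h2 : r0 ^ 2 ≤ R0 ^ 2 := pow_le_pow_left₀ hr0.le hr0R 2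
    have h3 : r0 ^ 3 ≤ R0 ^ 3 := pow_le_pow_left₀ hr0.le hr0R 3
    nlinarith [mul_le_mul_of_nonneg_right h2 hC0', mul_le_mul_of_nonneg_right h3 hC1']
  have hE : 0 ≤ Real.exp ((3 + 1) * κ₁) * A * (((Lc ^ (n + 2) : ℕ) : ℝ) ^ (3 + 1 + 1))⁻¹ * K * (2 / ((Lc ^ (n + 1) : ℕ) : ℝ)) := by
    positivity
  calc Real.exp ((3 + 1) * κ₁) * A * (((Lc ^ (n + 2) : ℕ) : ℝ) ^ (3 + 1 + 1))⁻¹ * K * (2 / ((Lc ^ (n + 1) : ℕ) : ℝ)) *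
        (r0 ^ 2 * C0 + r0 ^ 3 * C1)
      ≤ Real.exp ((3 + 1) * κ₁) * A * (((Lc ^ (n + 2) : ℕ) : ℝ) ^ (3 + 1 + 1))⁻¹ * K * (2 / ((Lc ^ (n + 1) : ℕ) : ℝ)) *
        (R0 ^ 2 * C0 + R0 ^ 3 * C1) := mul_le_mul_of_nonneg_left hW hE
    _ = Real.exp ((3 + 1) * κ₁) * A * K * 2 * (R0 ^ 2 * C0 + R0 ^ 3 * C1) * ((((Lc ^ (n + 2) : ℕ) : ℝ)) ^ 5)⁻¹ *
        ((Lc : ℝ)⁻¹) ^ (n + 1) := by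
        push_cast
        rw [inv_pow]
        ring

end Four

end Summit.QuantumFields.BalabanUV.Beta.GAN24.FineReadoutCauchyTail

end

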